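import Summits.Parity.GeneralizedHardyLittlewood.Theorems.LeeYangFibresCellParityLawSavingEngineDefs
import Summits.Parity.GeneralizedHardyLittlewood.Theorems.LeeYangFibresCellParityLawGeThreeHyp
import HarnessLib

/-!
# Route `LeeYangFibres`, crux `CellParityLawSaving` (stmt-Parity-18104), line `superpoly-band-same-atom`
# (payload slug `SketchIdeator3`): the registered stub `stub_hypAlong` — the kernel's hypotheses for the
# localised section sequence ALONG THE SCHEDULE

We prove the registered stub `stub_hypAlong : HypAlong` of skeleton v2
(`Cruxes/CellParityLawSaving/Lines/SketchIdeator3.lean`):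

  `SectionSeqBFacts → SectionSeqBCells → SectionDimension → SectionDimensionLow →
     (∀ t ≥ 1, SectionLevelAlong t) → ∀ t ≥ 1, KernelReadySavAt t`,

i.e. that for `N ≥ N₀(t, L, A, B₂)` the Bombieri-normalised section sequence `𝒜 = secSeqB Ψ K N U i j'` at the
scheduled roughness `U = U(N) = slowDegree N = max 4 ⌊√(log log N)/2⌋` — of a non-degenerate system of size
`≤ L`, a convex body `K ⊆ [-N,N]` localised to `ψ_i > x/Λ`, a coordinate with no degenerate prime and frozen
cells `j' ∈ [1,U]^t` — with the parameters `x = 2LN`, `z = N^{1/U}`, `η = 2(log log N)^{-B₂}`, `Λ = (log N)^{t+2}`,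
`w₀ = (log N)²`, `R = N/(log N)^A`, `A₁ = t + 2`, `L' = max(L'_{dim}, L₁)` satisfies every hypothesis of the
kernel `SuperPolyRoughCellLaw` VERBATIM (the statement `KernelReadySavAt t` of
`LeeYangFibresCellParityLawSavingEngineDefs`).

How. This is the sister crux's landed `stub_geThreeHyp` (`LeeYangFibresCellParityLawGeThreeHyp`, fixed roughness
`u`) re-run at `u := U(N)`. Everything `u`-generic is consumed by name: the `secSeqB` identities
(`SectionSeqBFacts`, `SectionSeqBCells`), the value bound `≤ 2LN` (`stub_prLawTwoPrep`), the two dimension bounds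
(`SectionDimension`, `SectionDimensionLow`), the `u`-free range conditions `GeThreeHypAux.range_z_upper`,
`eventually_range_eta_lower`, `eventually_logpow_le_xpow_eta`, `eventually_level_le`, and the atom ALONG THE
SCHEDULE `SectionLevelAlong t` applied at `u := U(N) ≤ U(N)` to the convex bodies `K ∩ {ψ_i ≤ y}` (level
`N^{1-(log log N)^{-B₂}} ≥ x^{1-η}`, saving `(log N)^{-A}`). The four `u`-DEPENDENT range conditions are redone
along the schedule from `quantClip_schedule` (`exp(4U²) ≤ log N`, so `4U² ≤ log log N` and `log N/U ≥ 4U`):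
* `2L + 2 ≤ 1 + 4U ≤ exp(log N/U) = N^{1/U}` once `L ≤ U(N)`, whence `(2LN)^{1/(U+1)} ≤ N^{1/U}`;
* `8U ≤ 4U² ≤ log log N ≤ (log log N)^{B₂}`, whence `η = 2(log log N)^{-B₂} ≤ 1/(4U)`;
* `4U (log 2L + (t+2) log log N) ≤ (log 2L + t + 2)(log log N)² ≤ log N` eventually, whence
  `2L (log N)^{t+2} ≤ N^{1/(4U)}` and `(2LN)^{1-1/(4U)} ≤ N/(log N)^{t+2}`;
* `U² ≤ 4U² ≤ log log N ≤ log log (2LN)`, whence the kernel's extra range condition `U ≤ √(log log x)`.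

References: E. Bombieri, Rend. Accad. Naz. XL (5) 1/2 (1975/76) [BombieriAsymptoticSieve1976]; RIMS Kôkyûroku
294 (1977) p. 5 [BombieriRIMS1977]; J. Friedlander, H. Iwaniec, Ann. Sc. Norm. Sup. Pisa (4) 5 (1978) §4
[FriedlanderIwaniecPisa1978]. No named fact is used: everything is composed from landed tree theorems.
-/

noncomputable section

open scoped BigOperators Classical
open Finset Filter Literature.NumberTheory.Sieve
open Summit.Parity.GeneralizedHardyLittlewood.Cruxes.CellParityLaw.SectionAnnihilator
open Summit.Parity.GeneralizedHardyLittlewood.Cruxes.AbsoluteUpgrade.DipMarginRateExchange (slowDegree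
  four_le_slowDegree quantClip_schedule)

namespace Summit.Parity.GeneralizedHardyLittlewood.Cruxes.CellParityLawSaving.SuperPolyBand

namespace HypAlongAux

/-! ## The schedule, eventually in `N` -/

/-- The facts of `quantClip_schedule` as an eventuality in `N`: `U₀ ≤ U(N)`, `16 ≤ N`,
`exp(4U(N)²) ≤ log N` and `log log N ≤ (2U(N)+2)²`. -/
theorem eventually_schedule (U₀ : ℕ) :
    ∀ᶠ N : ℕ in atTop, U₀ ≤ slowDegree N ∧ 16 ≤ N ∧
      Real.exp (4 * (slowDegree N : ℝ) ^ 2) ≤ Real.log N ∧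
      Real.log (Real.log N) ≤ (2 * (slowDegree N : ℝ) + 2) ^ 2 := by
  obtain ⟨N₀, hN₀⟩ := quantClip_schedule U₀
  exact Filter.eventually_atTop.2 ⟨N₀, hN₀⟩

/-- Pointwise numerology of the schedule: from `4 ≤ U`, `16 ≤ N` and `exp(4U²) ≤ log N` one gets
`4U² + 1 ≤ log N`, `4U² ≤ log log N` and `1 + 4U ≤ N^{1/U}` (`N^{1/U} = exp(log N/U) ≥ 1 + log N/U` and
`log N/U ≥ 4U`). -/
theorem schedule_pointwise {U N : ℕ} (hU4 : 4 ≤ U) (hN16 : 16 ≤ N)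
    (hexpU : Real.exp (4 * (U : ℝ) ^ 2) ≤ Real.log N) :
    4 * (U : ℝ) ^ 2 + 1 ≤ Real.log N ∧ 4 * (U : ℝ) ^ 2 ≤ Real.log (Real.log N) ∧
      1 + 4 * (U : ℝ) ≤ (N : ℝ) ^ ((1 : ℝ) / U) := by
  have hU4R : (4 : ℝ) ≤ U := by exact_mod_cast hU4
  have hUpos : (0 : ℝ) < U := by linarith
  have hN1R : (1 : ℝ) < N := by exact_mod_cast (by omega : 1 < N)
  have hN0 : (0 : ℝ) < N := by linarith
  have h4U2 : 4 * (U : ℝ) ^ 2 + 1 ≤ Real.log N := le_trans (Real.add_one_le_exp _) hexpU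
  have hlN0 : 0 < Real.log N := by nlinarith
  have hll4 : 4 * (U : ℝ) ^ 2 ≤ Real.log (Real.log N) := by
    rw [Real.le_log_iff_exp_le hlN0]; exact hexpU
  have hz_exp : (N : ℝ) ^ ((1 : ℝ) / U) = Real.exp (Real.log N / U) := by
    rw [Real.rpow_def_of_pos hN0]; congr 1; ring
  have hlNU : 4 * (U : ℝ) ≤ Real.log N / U := by
    rw [le_div_iff₀ hUpos]; nlinarith
  have hz4U : 1 + 4 * (U : ℝ) ≤ (N : ℝ) ^ ((1 : ℝ) / U) := by
    rw [hz_exp]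
    calc 1 + 4 * (U : ℝ) ≤ Real.log N / U + 1 := by linarith
      _ ≤ Real.exp (Real.log N / U) := Real.add_one_le_exp _
  exact ⟨h4U2, hll4, hz4U⟩

/-! ## The four `u`-dependent range conditions along the schedule -/

/-- Pointwise: `2L ≤ N^{1/u}` gives `(2LN)^{1/(u+1)} ≤ N^{1/u}` (`u, N > 0`; the `rpow` algebra of
`GeThreeHypAux.eventually_range_z_lower`). -/
theorem range_z_lower_of {L u N : ℕ} (hu : 0 < u) (hN : 0 < N)
    (h2L : 2 * (L : ℝ) ≤ (N : ℝ) ^ ((1 : ℝ) / u)) :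
    (2 * (L : ℝ) * N) ^ (1 / ((u : ℝ) + 1)) ≤ (N : ℝ) ^ ((1 : ℝ) / u) := by
  have hu0 : (0 : ℝ) < u := by exact_mod_cast hu
  have hN0 : (0 : ℝ) < N := by exact_mod_cast hN
  -- `2LN ≤ N^{1/u} · N = N^{1/u + 1}`
  have hle : 2 * (L : ℝ) * N ≤ (N : ℝ) ^ ((1 : ℝ) / u + 1) := by
    rw [Real.rpow_add hN0, Real.rpow_one]
    exact mul_le_mul_of_nonneg_right h2L hN0.le
  have hexp : 0 ≤ 1 / ((u : ℝ) + 1) := by positivity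
  calc (2 * (L : ℝ) * N) ^ (1 / ((u : ℝ) + 1))
      ≤ ((N : ℝ) ^ ((1 : ℝ) / u + 1)) ^ (1 / ((u : ℝ) + 1)) :=
        Real.rpow_le_rpow (by positivity) hle hexp
    _ = (N : ℝ) ^ ((1 : ℝ) / u) := by
        rw [← Real.rpow_mul hN0.le]
        congr 1
        field_simp
        ring

/-- Eventually along the schedule `(2LN)^{1/(U+1)} ≤ N^{1/U}`, `U = U(N)`: once `L ≤ U(N)` one has
`2L ≤ 2U ≤ 1 + 4U ≤ N^{1/U}`. -/
theorem eventually_range_z_lower_along (L : ℕ) :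
    ∀ᶠ N : ℕ in atTop, (2 * (L : ℝ) * N) ^ (1 / ((slowDegree N : ℝ) + 1)) ≤
      (N : ℝ) ^ ((1 : ℝ) / (slowDegree N : ℕ)) := by
  filter_upwards [eventually_schedule L] with N hN
  obtain ⟨hLU, hN16, hexpU, -⟩ := hN
  have hU4 := four_le_slowDegree N
  obtain ⟨-, -, hz⟩ := schedule_pointwise hU4 hN16 hexpU
  have hLU' : (L : ℝ) ≤ slowDegree N := by exact_mod_cast hLU
  refine range_z_lower_of (by omega) (by omega) ?_
  linarith

/-- Eventually along the schedule `2/(log log N)^{B₂} ≤ 1/(4U)`, `U = U(N)` (`B₂ ≥ 1`):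
`8U ≤ 4U² ≤ log log N ≤ (log log N)^{B₂}`. -/
theorem eventually_range_eta_upper_along (B₂ : ℕ) (hB₂ : 1 ≤ B₂) :
    ∀ᶠ N : ℕ in atTop, 2 / Real.log (Real.log (N : ℝ)) ^ B₂ ≤ 1 / (4 * (slowDegree N : ℝ)) := by
  filter_upwards [eventually_schedule 0] with N hN
  obtain ⟨-, hN16, hexpU, -⟩ := hN
  have hU4 := four_le_slowDegree N
  obtain ⟨-, hll4, -⟩ := schedule_pointwise hU4 hN16 hexpU
  set ℓℓ := Real.log (Real.log (N : ℝ)) with hℓℓ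
  have hU4R : (4 : ℝ) ≤ slowDegree N := by exact_mod_cast hU4
  have h8 : 8 * (slowDegree N : ℝ) ≤ 4 * (slowDegree N : ℝ) ^ 2 := by nlinarith
  have h1 : 1 ≤ ℓℓ := by nlinarith
  have hpow : ℓℓ ≤ ℓℓ ^ B₂ := le_self_pow₀ h1 (by omega)
  rw [div_le_div_iff₀ (by positivity) (by positivity)]
  linarith

/-- Pointwise: the size range condition `(2LN)^{1-1/(4U)} ≤ N/(log N)^{t+2}` from
`4U (log 2L + (t+2) log log N) ≤ log N` (then `2L (log N)^{t+2} ≤ N^{1/(4U)}`; the `rpow` algebra of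
`GeThreeHypAux.eventually_size_lower`). -/
theorem size_lower_of {L t N : ℕ} {U : ℝ} (hL : 1 ≤ L) (hN : 2 ≤ N) (hU : 0 < U)
    (hkey : 4 * U * (Real.log (2 * (L : ℝ)) + ((t : ℝ) + 2) * Real.log (Real.log (N : ℝ))) ≤
      Real.log (N : ℝ)) :
    (2 * (L : ℝ) * N) ^ (1 - 1 / (4 * U)) ≤ (N : ℝ) / Real.log N ^ (t + 2) := by
  have hL1 : (1 : ℝ) ≤ L := by exact_mod_cast hL
  set c : ℝ := 1 / (4 * U) with hc
  have hc0 : 0 < c := by rw [hc]; positivity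
  have hN0 : (0 : ℝ) < N := by exact_mod_cast (by omega : 0 < N)
  have hlog0 : 0 < Real.log (N : ℝ) := Real.log_pos (by exact_mod_cast (by omega : 1 < N))
  have hlogpow : 0 < Real.log (N : ℝ) ^ (t + 2) := pow_pos hlog0 _
  have hx0 : 0 < 2 * (L : ℝ) * N := by positivity
  -- `(2LN)^{1-c} = 2LN · (2LN)^{-c} ≤ 2LN · N^{-c}`
  have h1 : (2 * (L : ℝ) * N) ^ (1 - c) ≤ 2 * (L : ℝ) * N * (N : ℝ) ^ (-c) := by
    rw [Real.rpow_sub hx0, Real.rpow_one, div_eq_mul_inv, ← Real.rpow_neg hx0.le]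
    refine mul_le_mul_of_nonneg_left ?_ hx0.le
    exact Real.rpow_le_rpow_of_nonpos hN0 (by nlinarith) (by linarith)
  -- `2L (log N)^{t+2} = exp(log 2L + (t+2) log log N) ≤ exp(c log N) = N^c`
  have hcl : Real.log (2 * (L : ℝ)) + ((t : ℝ) + 2) * Real.log (Real.log (N : ℝ)) ≤
      Real.log N * c := by
    rw [hc, mul_one_div, le_div_iff₀ (by positivity)]
    linarith
  have e1 : Real.exp (Real.log (2 * (L : ℝ)) + ((t : ℝ) + 2) * Real.log (Real.log (N : ℝ))) =
      2 * (L : ℝ) * Real.log (N : ℝ) ^ (t + 2) := by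
    rw [Real.exp_add, Real.exp_log (by positivity : (0 : ℝ) < 2 * L), mul_comm ((t : ℝ) + 2),
      ← Real.rpow_def_of_pos hlog0, show ((t : ℝ) + 2) = ((t + 2 : ℕ) : ℝ) by push_cast; ring,
      Real.rpow_natCast]
  have h2 : 2 * (L : ℝ) * Real.log (N : ℝ) ^ (t + 2) ≤ (N : ℝ) ^ c := by
    rw [← e1, Real.rpow_def_of_pos hN0]
    exact Real.exp_le_exp.mpr hcl
  rw [le_div_iff₀ hlogpow]
  calc (2 * (L : ℝ) * N) ^ (1 - c) * Real.log (N : ℝ) ^ (t + 2)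
      ≤ 2 * (L : ℝ) * N * (N : ℝ) ^ (-c) * Real.log (N : ℝ) ^ (t + 2) :=
        mul_le_mul_of_nonneg_right h1 hlogpow.le
    _ = (N : ℝ) ^ (-c) * N * (2 * (L : ℝ) * Real.log (N : ℝ) ^ (t + 2)) := by ring
    _ ≤ (N : ℝ) ^ (-c) * N * (N : ℝ) ^ c :=
        mul_le_mul_of_nonneg_left h2 (by positivity)
    _ = N := by
        rw [mul_comm, ← mul_assoc, ← Real.rpow_add hN0, add_neg_cancel, Real.rpow_zero, one_mul]

/-- Eventually along the schedule `(2LN)^{1-1/(4U)} ≤ N/(log N)^{t+2}`, `U = U(N)` (`L ≥ 1`):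
`4U (log 2L + (t+2) log log N) ≤ log log N · (log 2L + (t+2) log log N) ≤ (log 2L + t + 2)(log log N)² ≤ log N`
for large `N` (`4U ≤ 4U² ≤ log log N`; `PrLawTwoAssemblyAux.eventually_const_mul_loglog_pow_le`). -/
theorem eventually_size_lower_along (L t : ℕ) (hL : 1 ≤ L) :
    ∀ᶠ N : ℕ in atTop, (2 * (L : ℝ) * N) ^ (1 - 1 / (4 * (slowDegree N : ℝ))) ≤
      (N : ℝ) / Real.log N ^ (t + 2) := by
  have hL1 : (1 : ℝ) ≤ L := by exact_mod_cast hL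
  have hlog2L : 0 ≤ Real.log (2 * (L : ℝ)) := Real.log_nonneg (by linarith)
  filter_upwards [eventually_schedule 0, PrLawTwoAssemblyAux.eventually_const_mul_loglog_pow_le 2
    (Real.log (2 * (L : ℝ)) + ((t : ℝ) + 2)) (by positivity)] with N hN hll
  obtain ⟨-, hN16, hexpU, -⟩ := hN
  have hU4 := four_le_slowDegree N
  obtain ⟨-, hll4, -⟩ := schedule_pointwise hU4 hN16 hexpU
  set U : ℝ := (slowDegree N : ℝ) with hU
  set ℓℓ := Real.log (Real.log (N : ℝ)) with hℓℓ
  have hU4R : (4 : ℝ) ≤ U := by rw [hU]; exact_mod_cast hU4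
  have h1 : 1 ≤ ℓℓ := by nlinarith
  have hll2 : ℓℓ ≤ ℓℓ ^ 2 := by nlinarith
  have h4U : 4 * U ≤ ℓℓ := by nlinarith
  refine size_lower_of hL (by omega) (by linarith) ?_
  have hA0 : 0 ≤ Real.log (2 * (L : ℝ)) + ((t : ℝ) + 2) * ℓℓ := by positivity
  calc 4 * U * (Real.log (2 * (L : ℝ)) + ((t : ℝ) + 2) * ℓℓ)
      ≤ ℓℓ * (Real.log (2 * (L : ℝ)) + ((t : ℝ) + 2) * ℓℓ) := mul_le_mul_of_nonneg_right h4U hA0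
    _ ≤ (Real.log (2 * (L : ℝ)) + ((t : ℝ) + 2)) * ℓℓ ^ 2 := by
        nlinarith [mul_le_mul_of_nonneg_left hll2 hlog2L]
    _ ≤ Real.log N := hll

/-- Eventually along the schedule the kernel's extra range condition `U(N) ≤ √(log log (2LN))` (`L ≥ 1`):
`U² ≤ 4U² ≤ log log N ≤ log log (2LN)`. -/
theorem eventually_sqrt_loglog_along (L : ℕ) (hL : 1 ≤ L) :
    ∀ᶠ N : ℕ in atTop, (slowDegree N : ℝ) ≤ Real.sqrt (Real.log (Real.log (2 * (L : ℝ) * N))) := by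
  have hL1 : (1 : ℝ) ≤ L := by exact_mod_cast hL
  filter_upwards [eventually_schedule 0] with N hN
  obtain ⟨-, hN16, hexpU, -⟩ := hN
  have hU4 := four_le_slowDegree N
  obtain ⟨-, hll4, -⟩ := schedule_pointwise hU4 hN16 hexpU
  have hN1R : (1 : ℝ) < N := by exact_mod_cast (by omega : 1 < N)
  have hN0 : (0 : ℝ) < N := by linarith
  have hlN0 : 0 < Real.log (N : ℝ) := Real.log_pos hN1R
  -- `log log N ≤ log log (2LN)`
  have hmono : Real.log (Real.log (N : ℝ)) ≤ Real.log (Real.log (2 * (L : ℝ) * N)) :=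
    Real.log_le_log hlN0 (Real.log_le_log hN0 (by nlinarith))
  refine Real.le_sqrt_of_sq_le ?_
  nlinarith [sq_nonneg (slowDegree N : ℝ)]

end HypAlongAux

open HypAlongAux GeThreeHypAux PrLawTwoAssemblyAux in
/-- **`stub_hypAlong`** (registered stub of skeleton v2, line `superpoly-band-same-atom`): the kernel's
hypotheses for the localised section sequence along the schedule, `HypAlong` — the sister's `stub_geThreeHyp`
at `u := U(N) = slowDegree N`, with the four `u`-dependent range conditions redone along the schedule and the
atom along the schedule applied at `u := U(N)`. -/
theorem stub_hypAlong : HypAlong := by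
  intro hF hC hD hDl hA t ht L A B₂ hB₂
  -- the vacuous case `L = 0` (a non-degenerate system has size `≥ 1`)
  rcases Nat.eq_zero_or_pos L with hL0 | hLpos
  · refine ⟨0, 0, fun N _ Ψ hΨ hL K _ _ i => ?_⟩
    have h1 : (1 : ℝ) ≤ (L : ℝ) := one_le_of_affLinSize_le Ψ hΨ hL i
    rw [hL0, Nat.cast_zero] at h1
    exact absurd h1 (by norm_num)
  have hL1 : 1 ≤ L := hLpos
  have hL1r : (1 : ℝ) ≤ L := by exact_mod_cast hL1
  -- constants
  obtain ⟨L', hL'⟩ := hD t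
  obtain ⟨L₁, N₁, hDl'⟩ := hDl t L
  set L'' : ℝ := max L' L₁ with hL''
  obtain ⟨NA, hAt⟩ := hA t ht L A B₂
  obtain ⟨-, -, -, hVal, -⟩ := stub_prLawTwoPrep
  -- all thresholds at once
  obtain ⟨N₀, hN₀⟩ := Filter.eventually_atTop.1 ((eventually_range_z_lower_along L).and
    ((eventually_range_eta_lower L B₂ hL1).and ((eventually_range_eta_upper_along B₂ hB₂).and
    ((eventually_logpow_le_xpow_eta L B₂ (t + 2) hL1).and ((eventually_logpow_le_xpow_eta L B₂ 2 hL1).and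
    ((eventually_size_lower_along L t hL1).and ((eventually_level_le L B₂ hL1).and
    ((eventually_sqrt_loglog_along L hL1).and
    (((Real.tendsto_log_atTop.comp tendsto_natCast_atTop_atTop).eventually_ge_atTop (2 : ℝ)).and
    ((eventually_ge_atTop NA).and ((eventually_ge_atTop N₁).and (eventually_ge_atTop 1))))))))))))
  refine ⟨L'', N₀, fun N hN Ψ hΨ hL K hK hKN i j' hj' hlt1 hKT hF0 => ?_⟩
  obtain ⟨hz1, hη1, hη2, hΛ, hw, hsz, hlev, hsqrt, hlog2, hNA, hNN₁, hNone⟩ := hN₀ N hN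
  have hNpos : 0 < N := hNone
  have hN0 : (0 : ℝ) < N := by exact_mod_cast hNpos
  have hlog2' : (2 : ℝ) ≤ Real.log (N : ℝ) := hlog2
  have hcoeff : (Ψ i).coeff ≠ 0 := hΨ.1 i
  have h2U : 2 ≤ slowDegree N := le_trans (by norm_num) (four_le_slowDegree N)
  -- the facts about the section sequence at the scheduled roughness
  obtain ⟨hsize, -, hrem, hsizeF, hdens, hconvle, -⟩ := hF t Ψ K N (slowDegree N) i j'
  obtain ⟨hwt, hsuppHi, hsuppLo, hcells, -, -⟩ := hC t Ψ K N (slowDegree N) i j'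
  have hvals : ∀ n ∈ latticeBox 1 N, (((Ψ i).eval n : ℤ) : ℝ) ≤ xOf L N := fun n hn =>
    hVal (t + 1) Ψ N L hNpos hL i n hn
  obtain ⟨hdensLe, hlow⟩ := hDl' N hNN₁ Ψ hΨ hL i hlt1
  simp only [xOf, zOf, etaOf, lamOf, wOf, rOf] at hKT hvals ⊢
  refine ⟨⟨hsqrt, hz1, range_z_upper hL1 N (slowDegree N), hη1, hη2, one_le_pow₀ (by linarith), hΛ, ?_, hw⟩,
    hwt hcoeff, fun q hq => hsuppHi _ q hvals hq, fun q hq => hsuppLo _ q hKT hq, hsize, ?_, ?_,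
    hasIwaniecDimension_mono (hL' Ψ i hlt1) (le_max_left _ _), ?_, ?_,
    fun m hm => hcells _ hvals m hm, hsizeF _ hvals, hdens _⟩
  · -- `2 ≤ (log N)²`
    nlinarith
  · -- size from below
    rw [hsizeF _ hvals]
    exact hsz.trans hF0
  · -- `g(p) ≤ (t+2)/p`
    intro p hp
    change sectionDensityFn Ψ i p ≤ _
    rw [sectionDensityFn_apply Ψ i hp.ne_zero]
    exact hdensLe p hp
  · -- the Mertens product from below above `w₀`, with `L'' ≥ L₁`
    intro w z' hw0 hwz hz'x
    have hlogw : 0 < Real.log w := Real.log_pos (by nlinarith)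
    have hlogz' : 0 ≤ Real.log z' := Real.log_nonneg (by nlinarith)
    have hprod : ∏ p ∈ (Nat.primesBelow ⌈z'⌉₊).filter (fun p : ℕ => w ≤ (p : ℝ)),
        (1 - (secSeqB Ψ K N (slowDegree N) i j').density p)⁻¹ =
        ∏ p ∈ (Nat.primesBelow ⌈z'⌉₊).filter (fun p : ℕ => w ≤ (p : ℝ)), (1 - sectionDensity Ψ i p)⁻¹ := by
      refine Finset.prod_congr rfl fun p hp => ?_
      have hp' : p.Prime := Nat.prime_of_mem_primesBelow (Finset.mem_filter.mp hp).1
      change (1 - sectionDensityFn Ψ i p)⁻¹ = _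
      rw [sectionDensityFn_apply Ψ i hp'.ne_zero]
    rw [hprod]
    refine le_trans ?_ (hlow w z' hw0 hwz hz'x)
    have h0 : 0 ≤ Real.log z' / Real.log w := div_nonneg hlogz' hlogw.le
    apply mul_le_mul_of_nonneg_left _ h0
    have : L₁ / Real.log w ≤ L'' / Real.log w :=
      div_le_div_of_nonneg_right (le_max_right _ _) hlogw.le
    linarith
  · -- Type-I for every truncation `y ≤ x`: the atom along the schedule, at `u := U(N)`, on `K ∩ {ψ_i ≤ y}`
    intro y _hy
    set Ky : Set (Fin 1 → ℝ) := K ∩ {v | (Ψ i).realEval v ≤ y} with hKy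
    have hKyconv : Convex ℝ Ky := hconvle y hK
    have hKysub : Ky ⊆ realBox 1 N := Set.inter_subset_left.trans hKN
    have hAtN := hAt N hNA (slowDegree N) h2U le_rfl Ψ hΨ hL Ky hKyconv hKysub i j' hj'
    have hterm : ∀ d ∈ (Finset.Icc 1 ⌊(2 * (L : ℝ) * N) ^ (1 - 2 / Real.log (Real.log (N : ℝ)) ^ B₂)⌋₊).filter
        Squarefree, |(secSeqB Ψ K N (slowDegree N) i j').remainder d y| =
          |(sectionMass Ψ Ky N (slowDegree N) i j' d : ℝ) -
            sectionDensity Ψ i d * (sectionMass Ψ Ky N (slowDegree N) i j' 1 : ℝ)| := by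
      intro d hd
      have hd1 : 1 ≤ d := (Finset.mem_Icc.mp (Finset.mem_filter.mp hd).1).1
      rw [hrem d y (by omega)]
    rw [Finset.sum_congr rfl hterm]
    refine le_trans (Finset.sum_le_sum_of_subset_of_nonneg ?_ fun _ _ _ => abs_nonneg _) hAtN
    intro d hd
    obtain ⟨hdI, hdsq⟩ := Finset.mem_filter.mp hd
    obtain ⟨hd1, hdle⟩ := Finset.mem_Icc.mp hdI
    exact Finset.mem_filter.mpr ⟨Finset.mem_Icc.mpr ⟨hd1, hdle.trans hlev⟩, hdsq⟩

end Summit.Parity.GeneralizedHardyLittlewood.Cruxes.CellParityLawSaving.SuperPolyBand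

end
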